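import Summits.NavierStokesRegularity.NavierStokesRegularity.Theorems.ExtremiserTransienceNearExtremalTransienceExtremiserLiouvilleConstantSpeedMultiplierExtension
import Literature.Analysis.FluidPDE.VorticityCalculus
import HarnessLib.Audit

/-!
# LINE g7-3 «l2_budget» — STUB T DECOMPOSED: the tail bound from a TAIL KIT and the μ-SIDE estimate

Companion of `Lines/l2_budget.lean` (stub T = `Sig.StubT`, the tail bound `s·μ{‖y‖ > s} ≤ C` for the multiplier of an axial residue
package satisfying the bounded-potential identity E — E is PROVED there).  This file reduces T to ONE typed target (T-i) and PROVES
everything else (`target_muSide` = T-v and the reduction `stubT_of_targets` are sorry-free; the only `sorry` is T-i):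

* `target_tailKit` (T-i, the EXPLICIT-FIELD PACKAGE; M): for every unit vector `e` there is a TAIL KIT — a smooth bounded potential `A`
  with graded decay (`‖DᵏA‖ ≤ C(1+‖x‖)^{-k}`, k ≤ 3: E's class), `K = curl A` constant on the closed unit ball, `‖K‖ ≤ C_K`, with WEIGHT
  `⟪K(x) − K(0), e⟫ ≥ 0` everywhere and `≥ κ > 0` for `‖x‖ ≥ Λ` (`Λ ≥ 2`), and such that for every constant-speed field `(w, c, M)` with
  `c = M e`: `A1(w, K(·/s)) ≥ 0`, `|J1(w, K(·/s))| ≤ C_J/s`, `|C1(w, K(·/s))| ≤ C_C/s` (`s ≥ 1`).  THE INTENDED WITNESS (pairing route,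
  module docstring of `Lines/l2_budget.lean`; LINE g7-1 signlaw T6): `K = ℙ(ψ e) = curl(e × ∇Ψ)` for the Newtonian potential `ψ` of a
  non-negative smooth shell density `h` on `{1 ≤ ‖x‖ ≤ 2}` (`Δψ = h`, `ΔΨ = ψ`; e.g. `r²ψ′ = g(r)` a smooth monotone step, `h = g′/r² ≥ 0`):
  `K ≡ (2ψ(0)/3)e` on `B₁` (Newton's theorem), `A = e × ∇Ψ = (G(r)/r³)(e × x)` bounded with `DᵏA = O(r^{-k})`;
  `A1(w, K_s) = (2M)⁻¹s⁻²∫h(x/s)‖w − c‖² ≥ 0` EXACTLY (`e × ω = ∇V_e − ∂_eV`, `V_e = −‖V‖²/2M` from `‖w‖ = ‖c‖ = M`, `div V = 0`);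
  `|J1(w,K_s)| ≤ s⁻¹‖DK‖_∞·3(‖Dw‖₂ + ‖ω‖₂)‖ω‖₂`; `C1(w,K_s) = −s⁻²∫⟪ω, (Δ curl K)(x/s)⟫`, `Δ curl K = ∇h × e` bounded on the shell, so
  `|C1| ≤ s^{-1/2}‖∇h‖_∞|shell|^{1/2}‖ω‖₂ ≤ C/s`... (indeed `O(s^{-1/2})`·`s^{-1}`·`s^{3/2}`·`s^{-2}` = `O(s^{-3/2})`); the weight is
  `(2/3ρ)·f(ρ/‖x‖, cos²∠(x,e)) ≥ 0` shell by shell (`f` certified in `Lines/kernel_budget_weight.lean`), `≥ 5/24` for `‖x‖ ≥ 8`.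
* `target_muSide` (T-v, the μ-SIDE; PROVED): for an axial residue package and a tail kit in the direction `e = c/M`,
  `∫⟪w, K(y/s)⟫dμ ≥ Mκ·μ{‖y‖ > Λs} − ε·μ{‖y‖ > s}` for `s ≥ s₁(ε)`: zero barycentre `∫w dμ = 0` removes `K(0)`, constancy of `K` on
  `B₁` localises to `‖y‖ > s`, the weight gives the main term, and `sup_{‖y‖>s}‖w − c‖ → 0` the error.

PROVED here: `stubT_of_targets : target_tailKit → target_muSide → Sig.StubT` — the identity E for the rescaled potentials
`s·A(s⁻¹x)` (class-stable: `rescale_boundedPotential`), the one-line energy bookkeeping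
`∫⟪w,K_s⟫dμ = S·J1 − κ⋆²M²(W·A1 + Z·C1) ≤ (|S|C_J + κ⋆²M²Z C_C)/s`, the choice `ε = Mκ/(2Λ)`, and the iteration `scale_iteration`.
Definitions `IsAxialResidue`, `BoundedPotentialIdentity`, `Sig.StubT` are CHARACTER-IDENTICAL copies from `Lines/l2_budget.lean` (crux
workfiles are not importable).  No summit, crux or K1b is proved here; T-i is the one sorried target (so, with E proved in
`Lines/l2_budget.lean`, stub T = T-i: the explicit-field package). [folklore]
-/

noncomputable section

open Set Filter Topology MeasureTheory Metric Function
open scoped ENNReal NNReal Topology InnerProductSpace RealInnerProductSpace ContDiff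
open Literature.Analysis.FluidPDE Literature.Analysis

namespace Summit.NavierStokesRegularity.NavierStokesRegularity.Cruxes.NearExtremalTransience.L2Budget.Tail

open Summit.NavierStokesRegularity.NavierStokesRegularity.Theorems
open Summit.NavierStokesRegularity.NavierStokesRegularity.Theorems.DepletionLadder
open Summit.NavierStokesRegularity.NavierStokesRegularity.Theorems.DepletionLadder.KStar
open Summit.NavierStokesRegularity.NavierStokesRegularity.Theorems.DepletionLadder.KStar.HalfSpace
open Summit.NavierStokesRegularity.NavierStokesRegularity.Theorems.ExtremiserLiouville

set_option linter.unusedVariables false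
set_option linter.dupNamespace false
set_option linter.style.longLine false

/-! ## Copies (character-identical) of the package, the identity class and the signature of stub T -/

/-- The AXIAL RESIDUE PACKAGE: a K1b residue object `(w, c, M)` in the axial frame `c = (0,0,c₂)` together with its KKT multiplier `μ`
(finite, exact mass, Euler–Lagrange identity on solenoidal `C_c^∞` tests, zero barycentre).  Every field is a THEOREM about any residue
object (K1b seat g2–g6); the bundle is exactly the list of binders of the axial dossier, minus its last three (Stokeslet law, blow-down
vorticity, flat-or-jet), which this line does not use. -/
def IsAxialResidue (w : E3 → E3) (c : E3) (M : ℝ) (μ : Measure E3) : Prop :=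
  AnalyticOnNhd ℝ w Set.univ ∧ ContDiff ℝ (⊤ : ℕ∞) w ∧ VectorCalculus.IsDivFree w ∧ (∃ B : ℝ, ∀ x, ‖fderiv ℝ w x‖ ≤ B) ∧
  (∫⁻ x, ‖iteratedFDeriv ℝ 1 w x‖ₑ ^ 2 < ⊤) ∧ (∫⁻ x, ‖iteratedFDeriv ℝ 2 w x‖ₑ ^ 2 < ⊤) ∧ (∀ x, ‖w x‖ = M) ∧ 0 < M ∧
  c 0 = 0 ∧ c 1 = 0 ∧ c 2 ≠ 0 ∧ ‖c‖ = M ∧ Tendsto (fun x => w x - c) (cocompact E3) (𝓝 0) ∧ MemLp (fun x => w x - c) 6 volume ∧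
  0 < M * Real.sqrt (Zen w) * Real.sqrt (Wpa w) ∧ kStar * M * Real.sqrt (Zen w) * Real.sqrt (Wpa w) = |Jst w| ∧
  IsFiniteMeasure μ ∧ M ^ 2 * μ.real univ = Jst w ^ 2 ∧
  (∀ φ : E3 → E3, ContDiff ℝ ∞ φ → HasCompactSupport φ → VectorCalculus.IsDivFree φ →
    Jst w * J1 w φ - kStar ^ 2 * M ^ 2 * (Wpa w * A1 w φ + Zen w * C1 w φ) = ∫ x, ⟪w x, φ x⟫_ℝ ∂μ) ∧
  (∫ x, w x ∂μ) = 0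

/-- The Euler–Lagrange identity on the BOUNDED-POTENTIAL test class: `φ = curl A`, `A` smooth and bounded with
`‖DᵏA(x)‖ ≤ C(1+‖x‖)^{−k}` for `k = 1,2,3` (so `φ = O(‖x‖⁻¹)`, `Dφ = O(‖x‖⁻²)`, `D curl φ = O(‖x‖⁻³)`).  One order slower than the tree's
`ExtremiserLiouville.multiplierIdentity_curl_of_decay` (`‖A‖ ≤ C(1+‖x‖)⁻¹`, `‖DᵏA‖ ≤ C(1+‖x‖)⁻²`). -/
def BoundedPotentialIdentity (w : E3 → E3) (M : ℝ) (μ : Measure E3) : Prop :=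
  ∀ (A : E3 → E3), ContDiff ℝ ∞ A → ∀ C : ℝ, (∀ x, ‖A x‖ ≤ C) →
    (∀ k : ℕ, 1 ≤ k → k ≤ 3 → ∀ x, ‖iteratedFDeriv ℝ k A x‖ ≤ C * ((1 + ‖x‖) ^ k)⁻¹) →
    Jst w * J1 w (curl A) - kStar ^ 2 * M ^ 2 * (Wpa w * A1 w (curl A) + Zen w * C1 w (curl A)) = ∫ x, ⟪w x, curl A x⟫_ℝ ∂μ

namespace Sig

/-- Signature of stub T (`stub_tailLaw`, rev 1.2: the WEAKEST form F needs): the multiplier of an axial residue package with the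
bounded-potential identity has tail `μ{‖y‖ > s} = O(1/s)` (`s ≥ 1`).  (The pairing route gives `o(1/s)`; `O` is all the budget uses, and
its derivation needs no tail-smallness of `ω, Dw` — only `‖ω‖₂, ‖Dw‖₂ < ∞`, `w − c → 0` at infinity, `b = 0` and `A1(K_s) ≥ 0`.) -/
def StubT : Prop :=
  ∀ (w : E3 → E3) (c : E3) (M : ℝ) (μ : Measure E3), IsAxialResidue w c M μ → BoundedPotentialIdentity w M μ →
    ∃ C : ℝ, ∀ s : ℝ, 1 ≤ s → s * μ.real {x : E3 | s < ‖x‖} ≤ C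

end Sig

/-! ## Constant-speed fields and TAIL KITS -/

/-- The analytic part of the package that the explicit-field estimates use. -/
def IsConstSpeedField (w : E3 → E3) (c : E3) (M : ℝ) : Prop :=
  ContDiff ℝ (⊤ : ℕ∞) w ∧ VectorCalculus.IsDivFree w ∧ (∃ B : ℝ, ∀ x, ‖fderiv ℝ w x‖ ≤ B) ∧
  (∫⁻ x, ‖iteratedFDeriv ℝ 1 w x‖ₑ ^ 2 < ⊤) ∧ (∫⁻ x, ‖iteratedFDeriv ℝ 2 w x‖ₑ ^ 2 < ⊤) ∧ (∀ x, ‖w x‖ = M) ∧ 0 < M ∧ ‖c‖ = M ∧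
  Tendsto (fun x => w x - c) (cocompact E3) (𝓝 0) ∧ MemLp (fun x => w x - c) 6 volume

/-- A TAIL KIT in the direction `e`: potential `A` in E's class, `K = curl A` constant on the closed unit ball and bounded, non-negative
weight `⟪K − K(0), e⟫` with a positive floor `κ` beyond radius `Λ ≥ 2`, and the three pairing estimates against every constant-speed field
with far field `M e`: `A1 ≥ 0`, `J1 = O(1/s)`, `C1 = O(1/s)` along the rescaled family `K(·/s)`. -/
def IsTailKit (e : E3) (A K : E3 → E3) (CK κ Λ : ℝ) : Prop :=
  ContDiff ℝ ∞ A ∧ (∃ C : ℝ, (∀ x, ‖A x‖ ≤ C) ∧ ∀ k : ℕ, 1 ≤ k → k ≤ 3 → ∀ x, ‖iteratedFDeriv ℝ k A x‖ ≤ C * ((1 + ‖x‖) ^ k)⁻¹) ∧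
  K = curl A ∧ (∀ x, ‖x‖ ≤ 1 → K x = K 0) ∧ 0 ≤ CK ∧ (∀ x, ‖K x‖ ≤ CK) ∧ 0 < κ ∧ 2 ≤ Λ ∧
  (∀ x, 0 ≤ ⟪K x - K 0, e⟫_ℝ) ∧ (∀ x, Λ ≤ ‖x‖ → κ ≤ ⟪K x - K 0, e⟫_ℝ) ∧
  (∀ (w : E3 → E3) (c : E3) (M : ℝ), IsConstSpeedField w c M → c = M • e →
    (∀ s : ℝ, 1 ≤ s → 0 ≤ A1 w (fun x => K (s⁻¹ • x))) ∧
    (∃ CJ : ℝ, ∀ s : ℝ, 1 ≤ s → |J1 w (fun x => K (s⁻¹ • x))| ≤ CJ / s) ∧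
    (∃ CC : ℝ, ∀ s : ℝ, 1 ≤ s → |C1 w (fun x => K (s⁻¹ • x))| ≤ CC / s))

/-! ## The target T-i and the (proved) μ-side T-v -/

/-- **T-i · target_tailKit (M).**  A tail kit exists in every direction.  Intended witness: `K = ℙ(ψe) = curl(e × ∇Ψ)`, `Δψ = h ≥ 0` a
smooth shell density on `{1 ≤ ‖x‖ ≤ 2}`, `ΔΨ = ψ` (module docstring: constancy on `B₁` by Newton's theorem, the exact `A1` formula
`(2M)⁻¹s⁻²∫h(x/s)‖w−c‖²`, the crude `J1`, `C1` bounds, the shell-by-shell weight `(2/3ρ)f ≥ 0`, floor `5/24` at `Λ = 8`).  Why it might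
fail: only in the explicit-field bookkeeping. [folklore] -/
theorem target_tailKit : ∀ e : E3, ‖e‖ = 1 → ∃ (A K : E3 → E3) (CK κ Λ : ℝ), IsTailKit e A K CK κ Λ := by
  sorry

/-- **T-v · target_muSide (PROVED).**  The μ-side of the pairing: for an axial residue package, a tail kit in the direction `e` with
`c = M e`, and `ε > 0`: `M κ μ{‖y‖ > Λs} − ε μ{‖y‖ > s} ≤ ∫⟪w, K(y/s)⟫dμ` for all large `s`.  Route: `∫w dμ = 0` ⇒
`∫⟪w, K_s⟫dμ = ∫_{‖y‖>s}⟪w, K(y/s) − K(0)⟫dμ` (constancy on `B₁`); split `w = c + (w − c)`: the `c`-part is `M∫_{‖y‖>s}⟪K(y/s) − K(0), e⟫dμ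
≥ Mκ μ{‖y‖ > Λ s}` (weight `≥ 0`, `≥ κ` beyond `Λ`), the rest is `≥ −2C_K sup_{‖y‖>s}‖w − c‖·μ{‖y‖ > s}` and `sup_{‖y‖>s}‖w − c‖ → 0`.
PROVED below (rev 1.1). [folklore] -/
theorem target_muSide : ∀ (w : E3 → E3) (c : E3) (M : ℝ) (μ : Measure E3), IsAxialResidue w c M μ →
    ∀ (e : E3) (A K : E3 → E3) (CK κ Λ : ℝ), IsTailKit e A K CK κ Λ → c = M • e →
    ∀ ε : ℝ, 0 < ε → ∃ s₁ : ℝ, 1 ≤ s₁ ∧ ∀ s : ℝ, s₁ ≤ s →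
      M * κ * μ.real {y : E3 | Λ * s < ‖y‖} - ε * μ.real {y : E3 | s < ‖y‖} ≤ ∫ y, ⟪w y, K (s⁻¹ • y)⟫_ℝ ∂μ := by
  intro w c M μ hP e A K CK κ Λ hK hce ε hε
  obtain ⟨han, hcd, hdiv, hB, h1, h2, hM, hMpos, hc0, hc1, hc2, hcM, hfar, hL6, hpos, heq, hfin, hmass, hμ, hb⟩ := hP
  obtain ⟨hA, ⟨CA, hA0, hAk⟩, hKA, hK1, hCK, hKb, hκ, hΛ, hw0, hwΛ, hfields⟩ := hK
  haveI := hfin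
  have hwcont : Continuous w := hcd.continuous
  have hKcont : Continuous K := by
    rw [hKA]; exact continuous_curl (hA.of_le (by exact_mod_cast le_top))
  -- the far field: `‖w y − c‖ ≤ δ` beyond some radius `R`
  set δ : ℝ := ε / (2 * CK + 1) with hδ
  have hδpos : 0 < δ := by positivity
  have hev : ∀ᶠ y in cocompact E3, ‖w y - c‖ < δ := by
    have h := Metric.tendsto_nhds.1 hfar δ hδpos
    filter_upwards [h] with y hy
    simpa [dist_zero_right] using hy
  obtain ⟨T, hTc, hT⟩ := mem_cocompact.1 hev
  obtain ⟨R, hR⟩ := hTc.isBounded.subset_closedBall (0 : E3)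
  refine ⟨max 1 R, le_max_left _ _, fun s hs => ?_⟩
  have hs1 : 1 ≤ s := (le_max_left _ _).trans hs
  have hsR : R ≤ s := (le_max_right _ _).trans hs
  have hs0 : 0 < s := lt_of_lt_of_le one_pos hs1
  have hdec : ∀ y : E3, s < ‖y‖ → ‖w y - c‖ ≤ δ := by
    intro y hy
    have hyT : y ∉ T := by
      intro h
      have h' := hR h
      rw [mem_closedBall, dist_zero_right] at h'
      linarith
    have h'' := hT hyT
    simp only [mem_setOf_eq] at h''
    exact h''.le
  -- the shifted kernel `g = K(·/s) − K(0)`: vanishes on `‖y‖ ≤ s`, bounded by `2 C_K`, weight facts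
  set g : E3 → E3 := fun y => K (s⁻¹ • y) - K 0 with hg
  have hnorm_scale : ∀ y : E3, ‖s⁻¹ • y‖ = s⁻¹ * ‖y‖ := fun y => by
    rw [norm_smul, Real.norm_eq_abs, abs_of_pos (inv_pos.2 hs0)]
  have hg0 : ∀ y : E3, ‖y‖ ≤ s → g y = 0 := by
    intro y hy
    have h : ‖s⁻¹ • y‖ ≤ 1 := by
      rw [hnorm_scale, inv_mul_le_iff₀ hs0, mul_one]; exact hy
    simp only [hg, hK1 _ h, sub_self]
  have hgb : ∀ y : E3, ‖g y‖ ≤ 2 * CK := fun y =>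
    (norm_sub_le _ _).trans (by linarith [hKb (s⁻¹ • y), hKb 0])
  have hge : ∀ y : E3, 0 ≤ ⟪g y, e⟫_ℝ := fun y => hw0 _
  have hgeΛ : ∀ y : E3, Λ * s < ‖y‖ → κ ≤ ⟪g y, e⟫_ℝ := by
    intro y hy
    apply hwΛ
    rw [hnorm_scale, le_inv_mul_iff₀ hs0]
    linarith
  -- integrability of the pieces (bounded continuous integrands, finite measure)
  have hKsm : Continuous fun y : E3 => K (s⁻¹ • y) := hKcont.comp (continuous_const_smul _)
  have hgcont : Continuous g := hKsm.sub continuous_const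
  have hint_w : Integrable w μ :=
    Integrable.of_bound hwcont.aestronglyMeasurable M (Eventually.of_forall fun y => (hM y).le)
  have hbd : ∀ (u v : E3 → E3) (a b : ℝ), Continuous u → Continuous v → (∀ y, ‖u y‖ ≤ a) → (∀ y, ‖v y‖ ≤ b) →
      Integrable (fun y => ⟪u y, v y⟫_ℝ) μ := by
    intro u v a b hu hv ha hb'
    refine Integrable.of_bound (hu.inner hv).aestronglyMeasurable (a * b) (Eventually.of_forall fun y => ?_)
    calc ‖⟪u y, v y⟫_ℝ‖ ≤ ‖u y‖ * ‖v y‖ := norm_inner_le_norm _ _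
      _ ≤ a * b := mul_le_mul (ha y) (hb' y) (norm_nonneg _) ((norm_nonneg _).trans (ha y))
  have hint2 : Integrable (fun y => ⟪c, g y⟫_ℝ) μ :=
    hbd (fun _ => c) g M (2 * CK) continuous_const hgcont (fun _ => hcM.le) hgb
  have hwc : ∀ y : E3, ‖w y - c‖ ≤ 2 * M := fun y =>
    (norm_sub_le _ _).trans (by linarith [hM y, hcM])
  have hint3 : Integrable (fun y => ⟪w y - c, g y⟫_ℝ) μ :=
    hbd (fun y => w y - c) g (2 * M) (2 * CK) (hwcont.sub continuous_const) hgcont hwc hgb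
  have hint0 : Integrable (fun y => ⟪K 0, w y⟫_ℝ) μ :=
    hbd (fun _ => K 0) w CK M continuous_const hwcont (fun _ => hKb 0) (fun y => (hM y).le)
  -- decomposition of the integrand
  have hptw : ∀ y : E3, ⟪w y, K (s⁻¹ • y)⟫_ℝ = ⟪c, g y⟫_ℝ + ⟪w y - c, g y⟫_ℝ + ⟪K 0, w y⟫_ℝ := by
    intro y
    simp only [hg, inner_sub_left, inner_sub_right, real_inner_comm (w y) (K 0)]
    ring
  have hI : ∫ y, ⟪w y, K (s⁻¹ • y)⟫_ℝ ∂μ =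
      ∫ y, ⟪c, g y⟫_ℝ ∂μ + ∫ y, ⟪w y - c, g y⟫_ℝ ∂μ + ∫ y, ⟪K 0, w y⟫_ℝ ∂μ := by
    have h23 : Integrable (fun y => ⟪c, g y⟫_ℝ + ⟪w y - c, g y⟫_ℝ) μ := hint2.add hint3
    rw [show (fun y => ⟪w y, K (s⁻¹ • y)⟫_ℝ) = fun y => (⟪c, g y⟫_ℝ + ⟪w y - c, g y⟫_ℝ) + ⟪K 0, w y⟫_ℝ from
      funext hptw, integral_add h23 hint0, integral_add hint2 hint3]
  have hI0 : ∫ y, ⟪K 0, w y⟫_ℝ ∂μ = 0 := by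
    rw [integral_inner hint_w, hb, inner_zero_right]
  have hmeasΛ : MeasurableSet {y : E3 | Λ * s < ‖y‖} := (isOpen_lt continuous_const continuous_norm).measurableSet
  have hmeas : MeasurableSet {y : E3 | s < ‖y‖} := (isOpen_lt continuous_const continuous_norm).measurableSet
  -- main term
  have hmain : M * κ * μ.real {y : E3 | Λ * s < ‖y‖} ≤ ∫ y, ⟪c, g y⟫_ℝ ∂μ := by
    have hind : ∀ y : E3, M * κ * ({y : E3 | Λ * s < ‖y‖}.indicator (fun _ => (1 : ℝ)) y) ≤ ⟪c, g y⟫_ℝ := by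
      intro y
      rw [hce, real_inner_smul_left, real_inner_comm]
      by_cases hy : Λ * s < ‖y‖
      · rw [indicator_of_mem (show y ∈ {y : E3 | Λ * s < ‖y‖} from hy), mul_one]
        exact mul_le_mul_of_nonneg_left (hgeΛ y hy) hMpos.le
      · rw [indicator_of_notMem (show y ∉ {y : E3 | Λ * s < ‖y‖} from hy), mul_zero]
        exact mul_nonneg hMpos.le (hge y)
    have hintind : Integrable (fun y : E3 => M * κ * ({y : E3 | Λ * s < ‖y‖}.indicator (fun _ => (1 : ℝ)) y)) μ :=
      ((integrable_const (1 : ℝ)).indicator hmeasΛ).const_mul _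
    calc M * κ * μ.real {y : E3 | Λ * s < ‖y‖}
        = ∫ y, M * κ * ({y : E3 | Λ * s < ‖y‖}.indicator (fun _ => (1 : ℝ)) y) ∂μ := by
          rw [integral_const_mul, integral_indicator_const _ hmeasΛ, smul_eq_mul, mul_one]
      _ ≤ ∫ y, ⟪c, g y⟫_ℝ ∂μ := integral_mono hintind hint2 hind
  -- error term
  have herr : -(ε * μ.real {y : E3 | s < ‖y‖}) ≤ ∫ y, ⟪w y - c, g y⟫_ℝ ∂μ := by
    have hδε : δ * (2 * CK) ≤ ε := by
      rw [hδ, div_mul_eq_mul_div, div_le_iff₀ (by positivity)]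
      nlinarith [hε, hCK]
    have hind : ∀ y : E3, -ε * ({y : E3 | s < ‖y‖}.indicator (fun _ => (1 : ℝ)) y) ≤ ⟪w y - c, g y⟫_ℝ := by
      intro y
      by_cases hy : s < ‖y‖
      · rw [indicator_of_mem (show y ∈ {y : E3 | s < ‖y‖} from hy), mul_one]
        have ha := abs_real_inner_le_norm (w y - c) (g y)
        have hb2 : ‖w y - c‖ * ‖g y‖ ≤ δ * (2 * CK) := mul_le_mul (hdec y hy) (hgb y) (norm_nonneg _) hδpos.le
        linarith [neg_abs_le ⟪w y - c, g y⟫_ℝ]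
      · rw [indicator_of_notMem (show y ∉ {y : E3 | s < ‖y‖} from hy), mul_zero, hg0 y (not_lt.1 hy), inner_zero_right]
    have hintind : Integrable (fun y : E3 => -ε * ({y : E3 | s < ‖y‖}.indicator (fun _ => (1 : ℝ)) y)) μ :=
      ((integrable_const (1 : ℝ)).indicator hmeas).const_mul _
    calc -(ε * μ.real {y : E3 | s < ‖y‖})
        = ∫ y, -ε * ({y : E3 | s < ‖y‖}.indicator (fun _ => (1 : ℝ)) y) ∂μ := by
          rw [integral_const_mul, integral_indicator_const _ hmeas, smul_eq_mul, mul_one, neg_mul]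
      _ ≤ ∫ y, ⟪w y - c, g y⟫_ℝ ∂μ := integral_mono hintind hint3 hind
  rw [hI, hI0, add_zero]
  linarith [hmain, herr]

/-! ## Proved glue: iteration and class-stability under rescaling (copies of `Lines/l2_budget_glue.lean`) -/

/-- **Iteration step of the tail law.**  `m ≥ 0`, `m ≤ m₀` on `[1,∞)`, `m(λ s) ≤ C₁/s + η(s) m(s)` and `0 ≤ η(s) ≤ 1/(2λ)` for `s ≥ s₀ ≥ 1`,
`λ > 1` ⇒ `s·m(s) ≤ max(λ s₀ m₀, 2λ|C₁|)` for all `s ≥ 1` (the lower bound `0 ≤ η` is not even needed, since `m ≥ 0`). -/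
theorem scale_iteration {m η : ℝ → ℝ} {m₀ C₁ lam s₀ : ℝ} (hlam : 1 < lam) (hs₀ : 1 ≤ s₀)
    (hm0 : ∀ s, 1 ≤ s → 0 ≤ m s) (hmb : ∀ s, 1 ≤ s → m s ≤ m₀)
    (hrec : ∀ s, s₀ ≤ s → m (lam * s) ≤ C₁ / s + η s * m s)
    (hη : ∀ s, s₀ ≤ s → η s ≤ 1 / (2 * lam)) :
    ∃ C : ℝ, ∀ s, 1 ≤ s → s * m s ≤ C := by
  have hlam0 : 0 < lam := lt_trans one_pos hlam
  have hm₀ : 0 ≤ m₀ := (hm0 1 le_rfl).trans (hmb 1 le_rfl)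
  set B : ℝ := max (lam * s₀ * m₀) (2 * lam * |C₁|) with hB
  have base : ∀ s, 1 ≤ s → s ≤ s₀ * lam → s * m s ≤ B := by
    intro s hs hsle
    calc s * m s ≤ (s₀ * lam) * m₀ := mul_le_mul hsle (hmb s hs) (hm0 s hs) (by positivity)
      _ = lam * s₀ * m₀ := by ring
      _ ≤ B := le_max_left _ _
  have key : ∀ n : ℕ, ∀ s, 1 ≤ s → s ≤ s₀ * lam ^ (n + 1) → s * m s ≤ B := by
    intro n
    induction n with
    | zero =>
        intro s hs hsle
        exact base s hs (by simpa using hsle)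
    | succ n ih =>
        intro s hs hsle
        by_cases hb : s ≤ s₀ * lam
        · exact base s hs hb
        · push Not at hb
          set s' : ℝ := s / lam with hs'
          have hss' : s = lam * s' := by rw [hs']; field_simp
          have hs'₀ : s₀ ≤ s' := by
            rw [hs', le_div_iff₀ hlam0]; exact hb.le
          have hs'1 : 1 ≤ s' := hs₀.trans hs'₀
          have hs'pos : 0 < s' := lt_of_lt_of_le one_pos hs'1
          have hs'le : s' ≤ s₀ * lam ^ (n + 1) := by
            rw [hs', div_le_iff₀ hlam0]
            calc s ≤ s₀ * lam ^ (n + 1 + 1) := hsle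
              _ = s₀ * lam ^ (n + 1) * lam := by ring
          have hih : s' * m s' ≤ B := ih s' hs'1 hs'le
          have hu0 : 0 ≤ s' * m s' := mul_nonneg hs'pos.le (hm0 s' hs'1)
          have hBC : 2 * lam * |C₁| ≤ B := le_max_right _ _
          calc s * m s = lam * s' * m (lam * s') := by rw [hss']
            _ ≤ lam * s' * (C₁ / s' + η s' * m s') :=
                mul_le_mul_of_nonneg_left (hrec s' hs'₀) (by positivity)
            _ = lam * C₁ + lam * η s' * (s' * m s') := by field_simp
            _ ≤ lam * |C₁| + lam * (1 / (2 * lam)) * B := by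
                apply add_le_add
                · exact mul_le_mul_of_nonneg_left (le_abs_self _) hlam0.le
                · exact mul_le_mul (mul_le_mul_of_nonneg_left (hη s' hs'₀) hlam0.le) hih hu0
                    (mul_nonneg hlam0.le (by positivity))
            _ = lam * |C₁| + B / 2 := by field_simp
            _ ≤ B := by linarith
  refine ⟨B, fun s hs => ?_⟩
  obtain ⟨n, hn⟩ := pow_unbounded_of_one_lt (s / s₀) hlam
  have hs₀pos : 0 < s₀ := lt_of_lt_of_le one_pos hs₀
  apply key n s hs
  have h1 : s < s₀ * lam ^ n := by
    rw [div_lt_iff₀ hs₀pos] at hn; linarith [hn]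
  have h2 : s₀ * lam ^ n ≤ s₀ * lam ^ (n + 1) := by
    apply mul_le_mul_of_nonneg_left _ hs₀pos.le
    exact pow_le_pow_right₀ hlam.le (Nat.le_succ n)
  linarith

section Rescale

variable {A : E3 → E3}

/-- **The bounded-potential class is scale-stable.**  For `A ∈ C^∞` with `‖A‖ ≤ C` and `‖DᵏA(x)‖ ≤ C(1+‖x‖)^{-k}` (`k = 1,2,3`) and `R ≥ 1`,
the rescaled potential `x ↦ R·A(R⁻¹x)` satisfies the same bounds with constant `C·R`, and its curl is `(curl A)(R⁻¹·)`.  (So lemma E,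
`L2Budget.boundedPotentialIdentity_holds`, applies to the whole family `K_s = (curl A)(·/s)`, `s ≥ 1`, of stub T.) [folklore] -/
theorem rescale_boundedPotential (hA : ContDiff ℝ ∞ A) {C : ℝ} (hA0 : ∀ x, ‖A x‖ ≤ C)
    (hAk : ∀ k : ℕ, 1 ≤ k → k ≤ 3 → ∀ x, ‖iteratedFDeriv ℝ k A x‖ ≤ C * ((1 + ‖x‖) ^ k)⁻¹) {R : ℝ} (hR : 1 ≤ R) :
    ContDiff ℝ ∞ (fun x => R • A (R⁻¹ • x)) ∧ (∀ x, ‖R • A (R⁻¹ • x)‖ ≤ C * R) ∧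
      (∀ k : ℕ, 1 ≤ k → k ≤ 3 → ∀ x, ‖iteratedFDeriv ℝ k (fun x => R • A (R⁻¹ • x)) x‖ ≤ C * R * ((1 + ‖x‖) ^ k)⁻¹) ∧
      curl (fun x => R • A (R⁻¹ • x)) = fun x => curl A (R⁻¹ • x) := by
  have hR0 : 0 < R := lt_of_lt_of_le one_pos hR
  have hRinv : 0 < R⁻¹ := inv_pos.2 hR0
  have hC0 : 0 ≤ C := (norm_nonneg _).trans (hA0 0)
  set L : E3 →L[ℝ] E3 := R⁻¹ • ContinuousLinearMap.id ℝ E3 with hL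
  have hLn : ‖L‖ ≤ R⁻¹ := by
    rw [hL, norm_smul, Real.norm_eq_abs, abs_of_pos hRinv]
    exact mul_le_of_le_one_right hRinv.le ContinuousLinearMap.norm_id_le
  have hcomp : (fun x => A (R⁻¹ • x)) = A ∘ L := by funext y; simp [hL]
  have hAL : ContDiff ℝ ∞ (fun x => A (R⁻¹ • x)) := by rw [hcomp]; exact hA.comp L.contDiff
  have hsm : ContDiff ℝ ∞ (fun x => R • A (R⁻¹ • x)) := hAL.const_smul R
  -- the weight: `(1 + ‖R⁻¹x‖)^{-m} R^{-m} ≤ (1 + ‖x‖)^{-m}`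
  have hw : ∀ x : E3, ∀ m : ℕ, ((1 + ‖R⁻¹ • x‖) ^ m)⁻¹ * (R⁻¹) ^ m ≤ ((1 + ‖x‖) ^ m)⁻¹ := by
    intro x m
    have hx : 0 < 1 + ‖x‖ := by positivity
    have h1 : 1 + ‖x‖ ≤ (1 + ‖R⁻¹ • x‖) * R := by
      rw [norm_smul, Real.norm_eq_abs, abs_of_pos hRinv, add_mul, one_mul,
        show R⁻¹ * ‖x‖ * R = ‖x‖ by field_simp]
      linarith [norm_nonneg x]
    have h2 : (1 + ‖x‖) ^ m ≤ ((1 + ‖R⁻¹ • x‖) * R) ^ m := pow_le_pow_left₀ hx.le h1 m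
    have h3 : ((1 + ‖R⁻¹ • x‖) ^ m)⁻¹ * (R⁻¹) ^ m = (((1 + ‖R⁻¹ • x‖) * R) ^ m)⁻¹ := by
      rw [mul_pow, mul_inv, inv_pow]
    rw [h3]
    exact inv_anti₀ (pow_pos hx m) h2
  refine ⟨hsm, fun x => ?_, fun k hk1 hk3 x => ?_, ?_⟩
  · rw [norm_smul, Real.norm_eq_abs, abs_of_pos hR0]
    calc R * ‖A (R⁻¹ • x)‖ ≤ R * C := mul_le_mul_of_nonneg_left (hA0 _) hR0.le
      _ = C * R := by ring
  · have e1 : iteratedFDeriv ℝ k (fun x => R • A (R⁻¹ • x)) x = R • iteratedFDeriv ℝ k (fun x => A (R⁻¹ • x)) x :=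
      iteratedFDeriv_const_smul_apply' (hAL.contDiffAt.of_le (by exact_mod_cast le_top))
    rw [e1, norm_smul, Real.norm_eq_abs, abs_of_pos hR0, hcomp,
      ContinuousLinearMap.iteratedFDeriv_comp_right L hA x (by exact_mod_cast le_top)]
    have h2 := ContinuousMultilinearMap.norm_compContinuousLinearMap_le (iteratedFDeriv ℝ k A (L x)) fun _ => L
    rw [Finset.prod_const, Finset.card_univ, Fintype.card_fin] at h2
    have h3 : ‖L‖ ^ k ≤ (R⁻¹) ^ k := pow_le_pow_left₀ (norm_nonneg _) hLn k
    have h4 : L x = R⁻¹ • x := by simp [hL]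
    have h5 := hAk k hk1 hk3 (L x)
    rw [h4] at h5
    have h6 := hw x k
    calc R * ‖(iteratedFDeriv ℝ k A (L x)).compContinuousLinearMap fun _ => L‖
        ≤ R * (‖iteratedFDeriv ℝ k A (L x)‖ * ‖L‖ ^ k) := mul_le_mul_of_nonneg_left h2 hR0.le
      _ ≤ R * (‖iteratedFDeriv ℝ k A (L x)‖ * (R⁻¹) ^ k) :=
          mul_le_mul_of_nonneg_left (mul_le_mul_of_nonneg_left h3 (norm_nonneg _)) hR0.le
      _ ≤ R * (C * ((1 + ‖R⁻¹ • x‖) ^ k)⁻¹ * (R⁻¹) ^ k) := by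
          rw [h4]
          exact mul_le_mul_of_nonneg_left (mul_le_mul_of_nonneg_right h5 (by positivity)) hR0.le
      _ = C * R * (((1 + ‖R⁻¹ • x‖) ^ k)⁻¹ * (R⁻¹) ^ k) := by ring
      _ ≤ C * R * ((1 + ‖x‖) ^ k)⁻¹ := mul_le_mul_of_nonneg_left h6 (by positivity)
  · funext x
    have hd : Differentiable ℝ A := hA.differentiable (by simp)
    have hdL : DifferentiableAt ℝ (fun x => A (R⁻¹ • x)) x := (hasFDerivAt_rescale hd R x).differentiableAt
    rw [show (fun x => R • A (R⁻¹ • x)) = fun x => R • (fun y => A (R⁻¹ • y)) x from rfl, curl_const_smul hdL,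
      curl_rescale hd, smul_smul, mul_inv_cancel₀ hR0.ne', one_smul]

end Rescale

/-! ## The reduction: T-i ∧ T-v ⇒ stub T (PROVED; with T-v proved above, stub T ⇐ T-i) -/

/-- **PROVED.**  `target_tailKit → target_muSide → Sig.StubT`. -/
theorem stubT_of_targets
    (hkit : ∀ e : E3, ‖e‖ = 1 → ∃ (A K : E3 → E3) (CK κ Λ : ℝ), IsTailKit e A K CK κ Λ)
    (hmu : ∀ (w : E3 → E3) (c : E3) (M : ℝ) (μ : Measure E3), IsAxialResidue w c M μ →
      ∀ (e : E3) (A K : E3 → E3) (CK κ Λ : ℝ), IsTailKit e A K CK κ Λ → c = M • e →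
      ∀ ε : ℝ, 0 < ε → ∃ s₁ : ℝ, 1 ≤ s₁ ∧ ∀ s : ℝ, s₁ ≤ s →
        M * κ * μ.real {y : E3 | Λ * s < ‖y‖} - ε * μ.real {y : E3 | s < ‖y‖} ≤ ∫ y, ⟪w y, K (s⁻¹ • y)⟫_ℝ ∂μ) :
    Sig.StubT := by
  intro w c M μ hP hid
  have hP' := hP
  obtain ⟨han, hcd, hdiv, hB, h1, h2, hM, hMpos, hc0, hc1, hc2, hcM, hfar, hL6, hpos, heq, hfin, hmass, hμ, hb⟩ := hP
  haveI := hfin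
  -- the direction `e = c/M`
  set e : E3 := M⁻¹ • c with he_def
  have he : ‖e‖ = 1 := by
    rw [he_def, norm_smul, Real.norm_eq_abs, abs_of_pos (inv_pos.2 hMpos), hcM, inv_mul_cancel₀ hMpos.ne']
  have hce : c = M • e := by
    rw [he_def, smul_smul, mul_inv_cancel₀ hMpos.ne', one_smul]
  obtain ⟨A, K, CK, κ, Λ, hK⟩ := hkit e he
  have hK' := hK
  obtain ⟨hA, ⟨CA, hA0, hAk⟩, hKA, hK1, hCK, hKb, hκ, hΛ, hw0, hwΛ, hfields⟩ := hK
  have hcs : IsConstSpeedField w c M := ⟨hcd, hdiv, hB, h1, h2, hM, hMpos, hcM, hfar, hL6⟩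
  obtain ⟨hA1, ⟨CJ, hJ1⟩, ⟨CC, hC1⟩⟩ := hfields w c M hcs hce
  -- the identity E on the rescaled potentials
  have hids : ∀ s : ℝ, 1 ≤ s →
      Jst w * J1 w (fun x => K (s⁻¹ • x)) - kStar ^ 2 * M ^ 2 * (Wpa w * A1 w (fun x => K (s⁻¹ • x)) + Zen w * C1 w (fun x => K (s⁻¹ • x))) =
        ∫ x, ⟪w x, K (s⁻¹ • x)⟫_ℝ ∂μ := by
    intro s hs
    obtain ⟨hsm, hb0, hbk, hcurl⟩ := rescale_boundedPotential hA hA0 hAk hs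
    have hid' := hid _ hsm (CA * s) hb0 hbk
    have hKs : (curl fun x => s • A (s⁻¹ • x)) = fun x => K (s⁻¹ • x) := by rw [hcurl, hKA]
    simpa only [hKs] using hid'
  -- signs
  have hZ : 0 ≤ Zen w := integral_nonneg fun x => by positivity
  have hW : 0 ≤ Wpa w := integral_nonneg fun x => frobeniusNormSq_nonneg _
  -- the upper bound `∫⟪w, K_s⟫dμ ≤ C₁/s`
  set C₁ : ℝ := |Jst w| * |CJ| + kStar ^ 2 * M ^ 2 * Zen w * |CC| with hC₁
  have hup : ∀ s : ℝ, 1 ≤ s → ∫ x, ⟪w x, K (s⁻¹ • x)⟫_ℝ ∂μ ≤ C₁ / s := by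
    intro s hs
    have hs0 : 0 < s := lt_of_lt_of_le one_pos hs
    rw [← hids s hs]
    have hJ := hJ1 s hs
    have hC := hC1 s hs
    have ha := hA1 s hs
    have hJabs : Jst w * J1 w (fun x => K (s⁻¹ • x)) ≤ |Jst w| * |CJ| / s := by
      calc Jst w * J1 w (fun x => K (s⁻¹ • x)) ≤ |Jst w * J1 w (fun x => K (s⁻¹ • x))| := le_abs_self _
        _ = |Jst w| * |J1 w (fun x => K (s⁻¹ • x))| := abs_mul _ _
        _ ≤ |Jst w| * (|CJ| / s) := by
            apply mul_le_mul_of_nonneg_left _ (abs_nonneg _)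
            exact hJ.trans (div_le_div_of_nonneg_right (le_abs_self _) hs0.le)
        _ = |Jst w| * |CJ| / s := by ring
    have hCabs : -(kStar ^ 2 * M ^ 2 * (Zen w * C1 w (fun x => K (s⁻¹ • x)))) ≤ kStar ^ 2 * M ^ 2 * Zen w * |CC| / s := by
      have h3 : -(Zen w * C1 w (fun x => K (s⁻¹ • x))) ≤ Zen w * (|CC| / s) := by
        calc -(Zen w * C1 w (fun x => K (s⁻¹ • x))) ≤ |Zen w * C1 w (fun x => K (s⁻¹ • x))| := neg_le_abs _
          _ = Zen w * |C1 w (fun x => K (s⁻¹ • x))| := by rw [abs_mul, abs_of_nonneg hZ]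
          _ ≤ Zen w * (|CC| / s) := by
              apply mul_le_mul_of_nonneg_left _ hZ
              exact hC.trans (div_le_div_of_nonneg_right (le_abs_self _) hs0.le)
      have h4 : 0 ≤ kStar ^ 2 * M ^ 2 := by positivity
      calc -(kStar ^ 2 * M ^ 2 * (Zen w * C1 w (fun x => K (s⁻¹ • x))))
          = kStar ^ 2 * M ^ 2 * (-(Zen w * C1 w (fun x => K (s⁻¹ • x)))) := by ring
        _ ≤ kStar ^ 2 * M ^ 2 * (Zen w * (|CC| / s)) := mul_le_mul_of_nonneg_left h3 h4
        _ = kStar ^ 2 * M ^ 2 * Zen w * |CC| / s := by ring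
    have hApart : -(kStar ^ 2 * M ^ 2 * (Wpa w * A1 w (fun x => K (s⁻¹ • x)))) ≤ 0 := by
      have : 0 ≤ kStar ^ 2 * M ^ 2 * (Wpa w * A1 w (fun x => K (s⁻¹ • x))) := by positivity
      linarith
    have hsplit : Jst w * J1 w (fun x => K (s⁻¹ • x)) -
        kStar ^ 2 * M ^ 2 * (Wpa w * A1 w (fun x => K (s⁻¹ • x)) + Zen w * C1 w (fun x => K (s⁻¹ • x))) =
        Jst w * J1 w (fun x => K (s⁻¹ • x)) + -(kStar ^ 2 * M ^ 2 * (Wpa w * A1 w (fun x => K (s⁻¹ • x)))) +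
          -(kStar ^ 2 * M ^ 2 * (Zen w * C1 w (fun x => K (s⁻¹ • x)))) := by ring
    rw [hsplit]
    calc Jst w * J1 w (fun x => K (s⁻¹ • x)) + -(kStar ^ 2 * M ^ 2 * (Wpa w * A1 w (fun x => K (s⁻¹ • x)))) +
          -(kStar ^ 2 * M ^ 2 * (Zen w * C1 w (fun x => K (s⁻¹ • x))))
        ≤ |Jst w| * |CJ| / s + 0 + kStar ^ 2 * M ^ 2 * Zen w * |CC| / s := add_le_add (add_le_add hJabs hApart) hCabs
      _ = C₁ / s := by rw [hC₁]; ring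
  -- the lower bound from the μ-side with `ε = Mκ/(2Λ)`
  have hΛ0 : 0 < Λ := lt_of_lt_of_le two_pos hΛ
  have hMκ : 0 < M * κ := mul_pos hMpos hκ
  obtain ⟨s₁, hs₁, hlow⟩ := hmu w c M μ hP' e A K CK κ Λ hK' hce (M * κ / (2 * Λ)) (by positivity)
  -- the recursion for `m(s) = μ.real {s < ‖y‖}`
  have hrec : ∀ s : ℝ, s₁ ≤ s →
      μ.real {y : E3 | Λ * s < ‖y‖} ≤ (C₁ / (M * κ)) / s + (1 / (2 * Λ)) * μ.real {y : E3 | s < ‖y‖} := by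
    intro s hs
    have hs1 : 1 ≤ s := hs₁.trans hs
    have hs0 : 0 < s := lt_of_lt_of_le one_pos hs1
    have h := (hlow s hs).trans (hup s hs1)
    -- `Mκ m(Λs) − (Mκ/(2Λ)) m(s) ≤ C₁/s`; divide by `Mκ > 0`
    have hMκne : M * κ ≠ 0 := hMκ.ne'
    have hsne : s ≠ 0 := hs0.ne'
    have hΛne : Λ ≠ 0 := hΛ0.ne'
    have h2 : M * κ * μ.real {y : E3 | Λ * s < ‖y‖} ≤
        M * κ * ((C₁ / (M * κ)) / s + (1 / (2 * Λ)) * μ.real {y : E3 | s < ‖y‖}) := by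
      have hexp : M * κ * ((C₁ / (M * κ)) / s + (1 / (2 * Λ)) * μ.real {y : E3 | s < ‖y‖}) =
          C₁ / s + M * κ / (2 * Λ) * μ.real {y : E3 | s < ‖y‖} := by
        field_simp
      rw [hexp]
      linarith
    exact le_of_mul_le_mul_left h2 hMκ
  have hm0 : ∀ s : ℝ, 1 ≤ s → 0 ≤ μ.real {y : E3 | s < ‖y‖} := fun s _ => measureReal_nonneg
  have hmb : ∀ s : ℝ, 1 ≤ s → μ.real {y : E3 | s < ‖y‖} ≤ μ.real univ := fun s _ => measureReal_mono (subset_univ _)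
  obtain ⟨C, hC⟩ := scale_iteration (m := fun s => μ.real {y : E3 | s < ‖y‖}) (η := fun _ => 1 / (2 * Λ)) (m₀ := μ.real univ)
    (C₁ := C₁ / (M * κ)) (lam := Λ) (s₀ := s₁) (lt_of_lt_of_le one_lt_two hΛ) hs₁ hm0 hmb hrec (fun s _ => le_rfl)
  exact ⟨C, hC⟩

/-- **PROVED.**  Stub T follows from the tail kit alone: `target_tailKit → Sig.StubT` (T-v is a theorem). -/
theorem stubT_of_tailKit
    (hkit : ∀ e : E3, ‖e‖ = 1 → ∃ (A K : E3 → E3) (CK κ Λ : ℝ), IsTailKit e A K CK κ Λ) : Sig.StubT :=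
  stubT_of_targets hkit target_muSide

/-- Stub T modulo the one remaining target (uses the `sorry` of `target_tailKit`). -/
theorem stubT_holds : Sig.StubT := stubT_of_tailKit target_tailKit

end Summit.NavierStokesRegularity.NavierStokesRegularity.Cruxes.NearExtremalTransience.L2Budget.Tail
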